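import Summits.Langlands.Langlands.Theorems.PicardMuOrdinaryMuOrdinaryFamilyRTDictionary
import Summits.Langlands.Langlands.Theorems.PicardMuOrdinaryIrregularClassicalityTraceDetect
import Summits.Langlands.Langlands.Theorems.PicardMuOrdinaryIrregularClassicalityResidualFrobTrace
import Summits.Langlands.Langlands.Theorems.PicardMuOrdinaryIrregularClassicalityAugmentationCharacter
import Literature.NumberTheory.GaloisRepresentations.GaloisRepOfLadicLimit
import Literature.NumberTheory.GaloisRepresentations.PicardLambdaAdicRepChebotarev
import Literature.NumberTheory.GaloisRepresentations.AbsIrreducibleIndexTwo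
import Literature.NumberTheory.GaloisRepresentations.StableLatticeValuationRing
import Literature.RepresentationTheory.Semisimple.BurnsideMatrixSpan
import HarnessLib

/-!
# Route `PicardMuOrdinary`, crux `IrregularClassicality` (stmt-Langlands-13758), line `slope-free-polarized-limit`:
# absolute irreducibility from RESIDUAL Frobenius traces

Continuation lead prover-line-stmt-Langlands-13758-c14-0, 2026-08-17 (skeleton r7/r8).  Part 2 of the elimination of the
Picard named fact from the crux (see `PicardMuOrdinaryIrregularClassicalityAvatarLimit.lean` for the assembly).

`isAbsolutelyIrreducible_of_frobTraces`: let `f ∈ ℤ[X]` be a generic quartic (`12 ∣ #Gal(f/ℚ)`), `K = ℚ(ω)`, and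
`ρ : Γ_K → GL₃(ℚ̄₃)` continuous with geometric-Frobenius traces `ι⁻¹ e(a_𝔭(f) ϖ_𝔭)` (`ϖ_𝔭 ≡ 1 (mod 3)`) at all
places off a finite set.  Then `ρ` is absolutely irreducible.  Proof: an integral model `ρ₀` over `ℤ̄₃`
(`exists_integralModel_of_valuationSubring`) has reduction `θ` with open kernel (`isOpen_ker_residualRep`, the maximal
ideal being the open unit ball); at good geometric Frobenii the residual trace of `θ` is `#Fix − 1` on the four roots of
`f_K` in `K̄` (registered stub S3 `stub_residualFrobTrace`, landed p145923: `a_𝔭 ϖ_𝔭 ≡ #roots(f mod 𝔭) − 1 (mod 1 − ω)`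
and Dedekind's dictionary), i.e. the character of the augmentation representation `(k^{roots})⁰` (registered stub S4
`stub_augmentationCharacter`, p145900); both sides are locally constant (open kernel; the open subgroup fixing the roots)
and the geometric Frobenii off a finite set are dense (Chebotarev, `frobenius_dense`), so the identity holds on all of
`Γ_K`; over an algebraic closure of the residue field (characteristic `3`, `PadicAlgCl.charP_residueField`) the
augmentation representation is irreducible (`augmentationRep_rootSet_map_isIrreducible`, `Gal ⊇ A₄`), hence `θ` is
irreducible there by TRACE DETECTION (registered stub S2 `stub_traceDetect`, p145915 — equal dimension is what makes
traces suffice in characteristic `3`), hence absolutely irreducible (Burnside: `span_eq_top_of_isIrreducible`,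
`span_range_map_eq_top_iff`, `span_eq_top_iff_forall_isIrreducible`), and `ρ` is absolutely irreducible
(Darmon–Diamond–Taylor §2.1, `IsResiduallyAbsIrreducible.isAbsolutelyIrreducible`).

References: H. Darmon, F. Diamond, R. Taylor, *Fermat's Last Theorem* (1995) §2.1; N. Bourbaki, *Algèbre* VIII §20
n°6; C. Upton, J. Algebra 322 (2009) §2; J.-P. Serre, *Abelian ℓ-adic representations* (1968) I §2.3.
-/

open Literature.NumberTheory.GaloisRepresentations Literature.NumberTheory.Automorphic
open Literature.RepresentationTheory.Semisimple
open scoped Pointwise NumberField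
open IsDedekindDomain NumberField Polynomial Filter Topology Field

-- `Summit.Langlands.Langlands.…` (summit = sub-problem name, D-0017 layout) trips `dupNamespace` on every decl.
set_option linter.dupNamespace false
set_option autoImplicit false

namespace Summit.Langlands.Langlands.Theorems.IrregularClassicality.SlopeFreePolarizedLimit

noncomputable section

/-! ### Step 3: absolute irreducibility from the residual traces (S2, S3, S4) -/

/-- Trace commutes with entrywise ring homomorphisms. -/
theorem trace_map_ringHom {R S : Type*} [CommRing R] [CommRing S] {n : Type*} [Fintype n]
    (f : R →+* S) (M : Matrix n n R) : (M.map f).trace = f M.trace := by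
  simp [Matrix.trace, Matrix.diag, map_sum]

/-- The fixed points of `g⁻¹` are those of `g`. -/
theorem natCard_fixed_inv {G X : Type*} [Group G] [MulAction G X] (g : G) :
    Nat.card {x : X // g⁻¹ • x = x} = Nat.card {x : X // g • x = x} :=
  Nat.card_congr (Equiv.subtypeEquivRight fun x => by
    rw [inv_smul_eq_iff, eq_comm])

/-- **Residual traces force absolute irreducibility.**  Let `f` be a generic quartic (`12 ∣ #Gal(f/ℚ)`) and
`ρ : Γ_K → GL₃(ℚ̄₃)` continuous with geometric-Frobenius traces `ι⁻¹ e(a_𝔭(f) ϖ_𝔭)`, `ϖ_𝔭 ≡ 1 (mod 3)`, at all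
places off a finite set.  Then `ρ` is absolutely irreducible: an integral model `ρ₀` over `ℤ̄₃`
(`exists_integralModel_of_valuationSubring`) has reduction `θ` with open kernel (`isOpen_ker_residualRep`); by S3 the
residual traces of `θ` at good geometric Frobenii are `#Fix − 1` on the four roots, i.e. (S4) the character of the
augmentation representation, and by density of Frobenii (Chebotarev, `frobenius_dense`) and local constancy this holds
on all of `Γ_K`; over an algebraic closure of the residue field the augmentation representation is irreducible
(`augmentationRep_rootSet_map_isIrreducible`), so `θ` is irreducible there by S2, hence absolutely irreducible
(Burnside, `span_eq_top_of_isIrreducible`, `span_range_map_eq_top_iff`, `span_eq_top_iff_forall_isIrreducible`), and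
`ρ` is absolutely irreducible (`IsResiduallyAbsIrreducible.isAbsolutelyIrreducible`). -/
theorem isAbsolutelyIrreducible_of_frobTraces (f : ℤ[X]) (hdeg : f.natDegree = 4)
    (hsep : (f.map (Int.castRingHom ℚ)).Separable) (hgal : 12 ∣ Nat.card (f.map (Int.castRingHom ℚ)).Gal)
    (ι : PadicAlgCl 3 ≃+* ℂ) (e : (CyclotomicField 3 ℚ) →+* ℂ) (S₀ : Finset (HeightOneSpectrum (𝓞 (CyclotomicField 3 ℚ))))
    (ϖ : HeightOneSpectrum (𝓞 (CyclotomicField 3 ℚ)) → 𝓞 (CyclotomicField 3 ℚ)) (ρ : FramedGaloisRep (CyclotomicField 3 ℚ) (PadicAlgCl 3) 3)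
    (hϖ : ∀ 𝔭 ∉ S₀, ϖ 𝔭 - 1 ∈ Ideal.span {(3 : 𝓞 (CyclotomicField 3 ℚ))})
    (htr : ∀ 𝔭 ∉ S₀, ∀ 𝔓 ∈ 𝔭.primesAbove, ∀ τ : absoluteGaloisGroup (CyclotomicField 3 ℚ), IsArithFrobAt (𝓞 (CyclotomicField 3 ℚ)) τ 𝔓 →
      FramedRep.trace ρ τ⁻¹ = ι.symm (e (↑(picardTrace f 𝔭 * ϖ 𝔭)))) :
    FramedRep.IsAbsolutelyIrreducible ρ := by
  classical
  -- (a) an integral model over `ℤ̄₃` and its reduction `θ`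
  set O : ValuationSubring (PadicAlgCl 3) := padicAlgClIntegers 3 with hOdef
  have hOmem : ∀ x : PadicAlgCl 3, x ∈ O ↔ ‖x‖ ≤ 1 := padicAlgCl_mem_valuationSubring_iff 3
  have hOopen : IsOpen (O : Set (PadicAlgCl 3)) := Valued.isOpen_valuationSubring _
  obtain ⟨Pm, ρ₀, hP⟩ := exists_integralModel_of_valuationSubring (O := O) hOopen ρ
  set κ : Type := IsLocalRing.ResidueField O with hκ
  set θ : absoluteGaloisGroup (CyclotomicField 3 ℚ) →* GL (Fin 3) κ :=
    (Matrix.GeneralLinearGroup.map (IsLocalRing.residue O)).comp ρ₀ with hθdef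
  have hθcoe : ∀ g, ((θ g : GL (Fin 3) κ) : Matrix (Fin 3) (Fin 3) κ) =
      ((ρ₀ g : GL (Fin 3) O) : Matrix (Fin 3) (Fin 3) O).map (IsLocalRing.residue O) := fun g => rfl
  have hker : IsOpen (θ.ker : Set (absoluteGaloisGroup (CyclotomicField 3 ℚ))) := by
    refine isOpen_ker_residualRep ?_ hP
    have heq : {x : PadicAlgCl 3 | ∃ h : x ∈ O, (⟨x, h⟩ : O) ∈ IsLocalRing.maximalIdeal O} = {x | ‖x‖ < 1} := by
      ext x
      simp only [Set.mem_setOf_eq]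
      constructor
      · rintro ⟨h, hx⟩
        exact (mem_maximalIdeal_iff_norm_lt_one hOmem ⟨x, h⟩).1 hx
      · intro hx
        exact ⟨(hOmem x).2 hx.le, (mem_maximalIdeal_iff_norm_lt_one hOmem _).2 hx⟩
    rw [heq]
    exact isOpen_lt continuous_norm continuous_const
  -- (b) traces of the integral model
  have htr0 : ∀ g, ((((ρ₀ g : GL (Fin 3) O) : Matrix (Fin 3) (Fin 3) O).trace : O) : PadicAlgCl 3) =
      FramedRep.trace ρ g := by
    intro g
    have h1 : (((ρ₀ g : GL (Fin 3) O) : Matrix (Fin 3) (Fin 3) O).map O.subtype) =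
        ((Matrix.GeneralLinearGroup.map O.subtype (ρ₀ g) : GL (Fin 3) (PadicAlgCl 3)) :
          Matrix (Fin 3) (Fin 3) (PadicAlgCl 3)) := rfl
    have h2 := trace_map_ringHom O.subtype ((ρ₀ g : GL (Fin 3) O) : Matrix (Fin 3) (Fin 3) O)
    rw [h1, hP g, Units.val_mul, Units.val_mul, Matrix.trace_units_conj'] at h2
    exact h2.symm
  -- (c) the residual trace at good geometric Frobenii (S3)
  haveI : IsCyclotomicExtension {3} ℚ (CyclotomicField 3 ℚ) := CyclotomicField.isCyclotomicExtension 3 ℚ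
  have hcardX : Fintype.card ((f.map (algebraMap ℤ (CyclotomicField 3 ℚ))).rootSet (AlgebraicClosure (CyclotomicField 3 ℚ))) = 4 :=
    card_rootSet_map_algebraMap_int (CyclotomicField 3 ℚ) hdeg hsep
  have hπ0 := fun {k : Type} [Field k] (h2 : (2 : k) ≠ 0) =>
    augmentationRep_rootSet_map_isIrreducible (K := (CyclotomicField 3 ℚ)) f hdeg hsep hgal h2
  set X := ((f.map (algebraMap ℤ (CyclotomicField 3 ℚ))).rootSet (AlgebraicClosure (CyclotomicField 3 ℚ))) with hXdef
  set Bad : Set (HeightOneSpectrum (𝓞 (CyclotomicField 3 ℚ))) := {v | ¬ ((3 : 𝓞 (CyclotomicField 3 ℚ)) ∉ v.asIdeal ∧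
      (f.map ((Ideal.Quotient.mk v.asIdeal).comp (algebraMap ℤ (𝓞 (CyclotomicField 3 ℚ))))).natDegree = 4 ∧
      (f.map ((Ideal.Quotient.mk v.asIdeal).comp (algebraMap ℤ (𝓞 (CyclotomicField 3 ℚ))))).Separable)} with hBad
  have hBadfin : Bad.Finite := picard_setOf_badPlace_finite f hdeg hsep
  set S' : Set (HeightOneSpectrum (𝓞 (CyclotomicField 3 ℚ))) := (S₀ : Set (HeightOneSpectrum (𝓞 (CyclotomicField 3 ℚ)))) ∪ Bad with hS'def
  have hS' : S'.Finite := S₀.finite_toSet.union hBadfin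
  set D : Set (absoluteGaloisGroup (CyclotomicField 3 ℚ)) :=
    {g | ∃ v ∉ S', ∃ 𝔓 ∈ v.primesAbove, IsArithFrobAt (𝓞 (CyclotomicField 3 ℚ)) g⁻¹ 𝔓} with hDdef
  have hD : Dense D := by
    have h := absoluteGaloisGroup.frobenius_dense chebotarev_artinRep_holds (CyclotomicField 3 ℚ) S' hS'
    exact h.preimage (Homeomorph.inv (absoluteGaloisGroup (CyclotomicField 3 ℚ))).isOpenMap
  have hresD : ∀ g ∈ D, IsLocalRing.residue O (((ρ₀ g : GL (Fin 3) O) : Matrix (Fin 3) (Fin 3) O).trace) =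
      (Nat.card {x : X // g • x = x} : κ) - 1 := by
    rintro g ⟨v, hv, 𝔓, h𝔓, hg⟩
    have hvS₀ : v ∉ S₀ := fun h => hv (Or.inl h)
    have hgood : (3 : 𝓞 (CyclotomicField 3 ℚ)) ∉ v.asIdeal ∧
        (f.map ((Ideal.Quotient.mk v.asIdeal).comp (algebraMap ℤ (𝓞 (CyclotomicField 3 ℚ))))).natDegree = 4 ∧
        (f.map ((Ideal.Quotient.mk v.asIdeal).comp (algebraMap ℤ (𝓞 (CyclotomicField 3 ℚ))))).Separable := by
      by_contra h
      exact hv (Or.inr h)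
    obtain ⟨hx, hresx⟩ := stub_residualFrobTrace f hdeg hsep ι e (ϖ v) (hϖ v hvS₀) v hgood.1 hgood.2.1
      hgood.2.2 𝔓 h𝔓 g⁻¹ hg
    have heq : (⟨ι.symm (e (↑(picardTrace f v * ϖ v))), hx⟩ : O) =
        ((ρ₀ g : GL (Fin 3) O) : Matrix (Fin 3) (Fin 3) O).trace := by
      apply Subtype.ext
      rw [htr0 g]
      have h := htr v hvS₀ 𝔓 h𝔓 g⁻¹ hg
      rw [inv_inv] at h
      exact h.symm
    rw [← heq, hresx, natCard_fixed_inv]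
  -- (d) … hence everywhere, by local constancy and density
  set ER : IntermediateField (CyclotomicField 3 ℚ) (AlgebraicClosure (CyclotomicField 3 ℚ)) :=
    IntermediateField.adjoin (CyclotomicField 3 ℚ) (X : Set (AlgebraicClosure (CyclotomicField 3 ℚ))) with hER
  haveI : FiniteDimensional (CyclotomicField 3 ℚ) ER :=
    IntermediateField.finiteDimensional_adjoin fun x _ => Algebra.IsIntegral.isIntegral x
  set H : Subgroup (absoluteGaloisGroup (CyclotomicField 3 ℚ)) :=
    (ER.fixingSubgroup).comap (absoluteGaloisGroup.toAlgEquiv (CyclotomicField 3 ℚ)).toMonoidHom with hHdef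
  have hHopen : IsOpen (H : Set (absoluteGaloisGroup (CyclotomicField 3 ℚ))) := ER.fixingSubgroup_isOpen
  have hHfix : ∀ h ∈ H, ∀ x : X, h • x = x := by
    intro h hh x
    apply Subtype.ext
    rw [rootSet.coe_smul, absoluteGaloisGroup.smul_def]
    exact (IntermediateField.mem_fixingSubgroup_iff _ _).1 hh _ (IntermediateField.subset_adjoin (CyclotomicField 3 ℚ) _ x.2)
  have hres : ∀ g, IsLocalRing.residue O (((ρ₀ g : GL (Fin 3) O) : Matrix (Fin 3) (Fin 3) O).trace) =
      (Nat.card {x : X // g • x = x} : κ) - 1 := by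
    intro g₀
    set U : Set (absoluteGaloisGroup (CyclotomicField 3 ℚ)) := (fun g => g₀⁻¹ * g) ⁻¹' ((H : Set _) ∩ (θ.ker : Set _)) with hU
    have hUopen : IsOpen U := (hHopen.inter hker).preimage (continuous_const_mul g₀⁻¹)
    have hg₀U : g₀ ∈ U := by
      show g₀⁻¹ * g₀ ∈ (H : Set _) ∩ (θ.ker : Set _)
      rw [inv_mul_cancel]
      exact ⟨H.one_mem, θ.ker.one_mem⟩
    obtain ⟨g, hgU, hgD⟩ := hD.inter_open_nonempty U hUopen ⟨g₀, hg₀U⟩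
    obtain ⟨hgH, hgker⟩ := hgU
    have hgg : g = g₀ * (g₀⁻¹ * g) := by group
    -- same residual matrix
    have hθeq : θ g = θ g₀ := by
      rw [hgg, map_mul, (MonoidHom.mem_ker).1 hgker, mul_one]
    -- same action on the roots
    have hsmul : ∀ x : X, g • x = g₀ • x := fun x => by
      rw [hgg, mul_smul, hHfix _ hgH x]
    have hcard : Nat.card {x : X // g • x = x} = Nat.card {x : X // g₀ • x = x} :=
      Nat.card_congr (Equiv.subtypeEquivRight fun x => by rw [hsmul x])
    have htrθ : ∀ h, IsLocalRing.residue O (((ρ₀ h : GL (Fin 3) O) : Matrix (Fin 3) (Fin 3) O).trace) =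
        ((θ h : GL (Fin 3) κ) : Matrix (Fin 3) (Fin 3) κ).trace := fun h => by
      rw [hθcoe, trace_map_ringHom]
    rw [htrθ, ← hθeq, ← htrθ, hresD g hgD, hcard]
  -- (e) the comparison over an algebraic closure of the residue field
  set K' : Type := AlgebraicClosure κ with hK'
  haveI : CharP κ 3 := PadicAlgCl.charP_residueField 3
  haveI : CharP K' 3 := charP_of_injective_algebraMap (algebraMap κ K').injective 3
  have h2 : (2 : K') ≠ 0 := by
    intro h
    have h' : ((2 : ℕ) : K') = 0 := by exact_mod_cast h
    rw [CharP.cast_eq_zero_iff K' 3] at h'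
    omega
  let fK : κ →+* K' := algebraMap κ K'
  set θ' : absoluteGaloisGroup (CyclotomicField 3 ℚ) →* GL (Fin 3) K' := (Matrix.GeneralLinearGroup.map fK).comp θ with hθ'def
  haveI : Nonempty X := by
    rw [← Fintype.card_pos_iff, hcardX]
    norm_num
  have hπ := hπ0 h2
  have hdim : Module.finrank K' (Fin 3 → K') = Module.finrank K' (augmentationSubmodule K' X) := by
    rw [Module.finrank_fin_fun, finrank_augmentationSubmodule, Nat.card_eq_fintype_card, hcardX]
  have htrace : ∀ g : absoluteGaloisGroup (CyclotomicField 3 ℚ),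
      LinearMap.trace K' (Fin 3 → K') (glRepresentation θ' g) =
        LinearMap.trace K' (augmentationSubmodule K' X) (augmentationRep K' (absoluteGaloisGroup (CyclotomicField 3 ℚ)) X g) := by
    intro g
    rw [stub_augmentationCharacter K' (absoluteGaloisGroup (CyclotomicField 3 ℚ)) X g]
    have e1 : (glRepresentation θ' g : (Fin 3 → K') →ₗ[K'] (Fin 3 → K')) =
        Matrix.toLin' ((θ' g : GL (Fin 3) K') : Matrix (Fin 3) (Fin 3) K') :=
      LinearMap.ext fun w => rfl
    have e2 : ((θ' g : GL (Fin 3) K') : Matrix (Fin 3) (Fin 3) K') =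
        ((θ g : GL (Fin 3) κ) : Matrix (Fin 3) (Fin 3) κ).map fK := rfl
    rw [e1, Matrix.trace_toLin'_eq, e2, trace_map_ringHom, hθcoe, trace_map_ringHom, hres g,
      map_sub, map_natCast, map_one]
  have hσ : (glRepresentation θ').IsIrreducible :=
    stub_traceDetect K' (absoluteGaloisGroup (CyclotomicField 3 ℚ)) (augmentationSubmodule K' X) (Fin 3 → K')
      (augmentationRep K' (absoluteGaloisGroup (CyclotomicField 3 ℚ)) X) (glRepresentation θ') hπ hdim htrace
  -- (f) Burnside: `θ` is absolutely irreducible, so `ρ` is residually absolutely irreducible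
  have hspan' := span_eq_top_of_isIrreducible (hirr := hσ) θ'
  simp_rw [hθ'def, coe_map_comp_apply] at hspan'
  have hspan := (span_range_map_eq_top_iff fK _).1 hspan'
  have habs : IsAbsIrreducible θ := (span_eq_top_iff_forall_isIrreducible (by norm_num) θ).1 hspan
  have hres' : ρ.IsResiduallyAbsIrreducible := by
    refine ⟨θ, ⟨ρ₀, 1, ⟨Pm, fun g => hP g⟩, fun g => ?_⟩, habs⟩
    rw [one_mul, inv_one, mul_one]
    rfl
  exact FramedGaloisRep.IsResiduallyAbsIrreducible.isAbsolutelyIrreducible (by norm_num) hres'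


/-- **Registered stub `stub_residualIrreducibility` of the line `slope-free-polarized-limit` (r7b)** — the closed form
of `isAbsolutelyIrreducible_of_frobTraces`. -/
theorem stub_residualIrreducibility :
    ∀ (f : ℤ[X]), f.natDegree = 4 → (f.map (Int.castRingHom ℚ)).Separable → 12 ∣ Nat.card (f.map (Int.castRingHom ℚ)).Gal →
    ∀ (ι : PadicAlgCl 3 ≃+* ℂ) (e : (CyclotomicField 3 ℚ) →+* ℂ) (S₀ : Finset (HeightOneSpectrum (𝓞 (CyclotomicField 3 ℚ))))
      (ϖ : HeightOneSpectrum (𝓞 (CyclotomicField 3 ℚ)) → 𝓞 (CyclotomicField 3 ℚ)) (ρ : FramedGaloisRep (CyclotomicField 3 ℚ) (PadicAlgCl 3) 3),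
      (∀ 𝔭 ∉ S₀, ϖ 𝔭 - 1 ∈ Ideal.span {(3 : 𝓞 (CyclotomicField 3 ℚ))}) →
      (∀ 𝔭 ∉ S₀, ∀ 𝔓 ∈ 𝔭.primesAbove, ∀ τ : absoluteGaloisGroup (CyclotomicField 3 ℚ), IsArithFrobAt (𝓞 (CyclotomicField 3 ℚ)) τ 𝔓 →
        FramedRep.trace ρ τ⁻¹ = ι.symm (e (↑(picardTrace f 𝔭 * ϖ 𝔭)))) →
      FramedRep.IsAbsolutelyIrreducible ρ :=
  fun f hdeg hsep hgal ι e S₀ ϖ ρ hϖ htr => isAbsolutelyIrreducible_of_frobTraces f hdeg hsep hgal ι e S₀ ϖ ρ hϖ htr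

end

end Summit.Langlands.Langlands.Theorems.IrregularClassicality.SlopeFreePolarizedLimit
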